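import Summits.QuantumFields.YangMills.Theorems.BalabanLadderIRPinnedExitCofinal
import Summits.QuantumFields.YangMills.Theorems.BalabanLadderIRRankPurityCofinal
import Summits.QuantumFields.YangMills.Theses.BalabanLadder
import Literature.MathematicalPhysics.QuantumFieldTheory.WilsonFinTorusTwistedPartitionDomination
import HarnessLib

/-!
# Crux `IRcof` (stmt-QuantumFields-26930) — LINE `twisted-slab-continuity` (ideator ym-ir-idea-20, lens `resurrect`, gen 0)
# PXcof(1∕24) ⇐ ANCHOR (twisted femto slab is pure) ∧ CONTINUITY in the transverse size (THE NAMED STALL) ∧ 't HOOFT REGIME at the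
# pinned cold box ∧ residual (groups without an isolating central twist); N_cof by name.  Assembles BY TOKEN onto the slot of
# record `Cruxes/IRcof/Lines/pinned_cofinal_bill.lean` rev 2 {PXcof(1∕24), N_cof} (LEAD ym-ir-line-ab-p1): this file's
# `PinnedExitsCofinalAt` is that file's, VERBATIM, and `IRcof_of_stubs` concludes `Theses.BalabanLadder.IRcof` LITERALLY.

RESURRECTED PRIOR ROUTES (stockroom `reserve/prior-2001/Prior/QuantumFields/YangMills/`, notes `docs/m5/inspiration/QuantumFields/YangMills/`):
`Ym_DeformedCenterStabilized*` (centre-stabilised ∕ deformed Yang–Mills continued adiabatically from a semiclassical small-circle regime;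
recorded stall «no estimate uniform in L across N·L·Λ ∼ 1»; in-tree descendant route `SmallCircleAnchor`, crux `AdiabaticContinuity`
stmt-QuantumFields-11142, DEAD for bare single-site Polyakov-loop deformations: `Theorems/AdiabaticContinuity/Negative/
AdiabaticContinuityFalseOfThermalWindowLRO.lean`, memo `Cruxes/AdiabaticContinuity/REFUTATION-c4.md`) and `Ym_FemtotorusFirst*`
(Lüscher's femto-universe as the weak-coupling anchor; recorded stall «step 5: the femto gap must survive L ↦ Lⁿ», twisted ∕ free-cube
variant named by its own audit as the repair for the toron degeneracy).  Stance: unfinished, not failed.  What is NEW relative to both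
(and to the in-tree dead line): the deformation is replaced by an 't HOOFT MAGNETIC TWIST through a 2-torus of transverse size `ℓ`
(a boundary condition — exact at every scale, nothing to renormalise away, so the c4 mechanism `ThermalWindowLRO` has no analogue), the
small-circle ∕ femto-cube anchor by the e-flux-projected TWISTED FEMTO SLAB `T²_ℓ(twist) × (L × t)` (unique twist-eating vacuum for an
ISOLATING twist — `SU(N)` with a generator of `Z_N` —, all modes massive at TREE level with lattice gap `≍ 1/(Nℓ)`: no Coulomb gas, no
Debye screening, no torons), and the continuation parameter by the transverse size `ℓ ↦ L` at FIXED coupling, along which no centre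
symmetry can break (directions `0,1` twist-eaten, direction `2` flux-projected) — the E4-G2 deconfinement edge of
`pub/ym-ir/FINITE-BOX-PURITY.md` (at aspect 4:1 the half-purity edge IS `β_c(N_τ)`) is exactly the obstruction on every PERIODIC thin-slab
path (N-fold deconfined vacua ⇒ defect `≥ 1 − 1/N`), and the twist deletes it.

STUBS (five; sorries ONLY here):
* `stub_anchor : TwistedSlabAnchor` — T1, LOCATED (weak-coupling cluster expansion about the isolated twist-eating vacuum of a
  2-dimensionally extended lattice system with complete symmetry breaking, Bałaban–Imbrie–Jaffe class); false for `U(1)` (no twist,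
  photon massless), vacuous for non-isolating twists by hypothesis.  First lemma of the line.
* `stub_continuity : TransverseSizeContinuity (1/96)` — T2, **THE NAMED STALL** of the prior route («no estimate uniform in L across
  N·L·Λ ∼ 1», here: purity of the projected twisted slab `(ℓ, ℓ, L; ⌊L/4⌋)` UNIFORM in `ℓ₀ ≤ ℓ ≤ L` at the floor-pinned scale
  `λ ≤ a(β)·L ≤ T`, cofinally in `β`, GIVEN the anchor at `ℓ₀`).  Width 0 in `ℓ = L`: Yang–Mills content.  Consumes `LowerBounds`.
* `stub_tHooftRegime : THooftRegime (1/96)` — T3, 't Hooft's confinement regime at the pinned cold box: EVERY central twist tensor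
  (electric and magnetic) costs at most the fraction `1/96` of `Z(L³ × ⌊L/4⌋)`, eventually in `β`, for all `L` in a floor-pinned window
  (flux-sector content only — cf. `TwistCost.FluxExitAt` (row 21 F, temporal twists, one exit scale) and `MarginalTwistOnset.ExpScaleTwistOnset`;
  false in a Coulomb phase at aspect 4:1).  Consumes `LowerBounds`.
* `stub_residual : NoIsolatingTwistResidual (1/24)` — DECLARED RESIDUAL: PXcof(1∕24) restricted to simply-connected compact simple `G`
  WITHOUT an isolating central twist of finite order (all simple types other than `A_{N−1}`: centre-free `G₂, F₄, E₈` — the prior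
  programme's own audit ruling «centre-based mechanisms cannot reach centre-free G» — and `B, C, D, E₆, E₇`, whose twists leave flat moduli).
  Not claimed; precedent: line 11's `irCentreFree`.
* `stub_irnscCof : IRnscCof` — N_cof BY NAME (slot token, `π₁(G) ≠ 1`).

PROVED here (no sorry): `slabTwist_center`, the averaging lemmas, the endpoint SEAM `coldDefect ≤ 1 − (1 − 1/96)³ ≤ 1/24` from
{projected twisted purity at `ℓ = L`, 't Hooft regime at `t = ⌊L/4⌋`, twist DOMINATION at `2⌊L/4⌋`
(`wilsonFinTorusTensorTwistedPartition_le_partition`, tree)}, `pxcof_of` (case split on the existence of an isolating twist),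
`irscCof_of_pxcof` (kernel `PinnedExitCofinal.ircofSC_of_pinnedExitsCofinal_le`), `IRcof_of : Bill`, `IRcof_of_stubs` (kernel
`RankPurity.IRcof_of_split`).

HONEST LABEL: ideation; nothing here proves `IRcof` (0∕1), `IR`, any leg, or the Yang–Mills mass gap (Clay: NOT proved); nothing
continuum ∕ OS; numerics quoted in the card are GUIDANCE; R4 closes only the conditional finite-𝕋⁴ rung `BalabanLadder.UV`.
-/

set_option autoImplicit false

noncomputable section

open Filter Topology MeasureTheory
open scoped BigOperators
open Literature.MathematicalPhysics.QuantumFieldTheory Literature.MathematicalPhysics.QuantumLattice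
open Summit.QuantumFields.YangMills.Cruxes.OSLegsFromFemtoAndGap.DlrCollarTransfer (LowerBounds)
open Summit.QuantumFields.YangMills.Cruxes.IR.ColdPurityBridge (coldDefect)
open Summit.QuantumFields.YangMills.Cruxes.IR.RankPurity (IRnscCof IRscCof IRcof_of_split)
open Summit.QuantumFields.YangMills.Cruxes.IR.PinnedExitCofinal (ircofSC_of_pinnedExitsCofinal_le)

namespace Summit.QuantumFields.YangMills.Cruxes.IRcof.TwistedSlabContinuity

/-! ## §1 Currency: the e-flux-projected, magnetically twisted slab -/

section Defs

variable {G : Type} [Group G] [TopologicalSpace G] [IsTopologicalGroup G] [CompactSpace G]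
  [MeasurableSpace G] [BorelSpace G]

/-- The slab twist tensor: magnetic twist `zM` on the plane `(0,1)` (the two transverse directions of size `ℓ`), electric twist `zE`
on the plane `(2,3)` (long direction `2` against Euclidean time `3`), no other twist ('t Hooft's `n_{01} = m₂`, `n_{23} = k₂`). -/
def slabTwist (zM zE : G) : Fin 4 → Fin 4 → G :=
  fun μ ν => if μ = 0 ∧ ν = 1 then zM else if μ = 2 ∧ ν = 3 then zE else 1

/-- **The projected twisted slab partition function** `Z^{proj}_{β}(ℓ, ℓ, L; t) := n⁻¹ Σ_{k<n} W{n_{01} = z, n_{23} = z^k}(ℓ,ℓ,L,t)`: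
the Wilson box `ℓ × ℓ × L × t` with 't Hooft's magnetic twist `z` through the transverse 2-torus, traced in the sector of ZERO electric
flux along the long direction `2` ('t Hooft 1979 (5.2)–(5.4): averaging the temporal twists `z^k`, `k < n`, `z^n = 1`, projects onto
`e₂ = 0`; a multiple `n` of the order of `z` gives the same average).  Real, a finite average of `wilsonFinTorusTensorTwistedPartition`s. -/
def projSlabZ {N : ℕ} (ρ : G →* Matrix (Fin N) (Fin N) ℂ) (β : ℝ) (z : G) (n : ℕ) (ℓ L t : ℕ) : ℝ :=
  (n : ℝ)⁻¹ * ∑ k : Fin n, wilsonFinTorusTensorTwistedPartition ρ β (slabTwist z (z ^ (k : ℕ))) ℓ ℓ L t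

/-- **The projected twisted slab purity defect** along Euclidean time at period `t ↦ 2t`:
`1 − Z^{proj}(ℓ,ℓ,L;2t) / Z^{proj}(ℓ,ℓ,L;t)²` (`= 1 − tr ϱ²` for the normalised `e₂ = 0`-projected thermal state of the twisted slice). -/
def projSlabDefect {N : ℕ} (ρ : G →* Matrix (Fin N) (Fin N) ℂ) (β : ℝ) (z : G) (n : ℕ) (ℓ L t : ℕ) : ℝ :=
  1 - projSlabZ ρ β z n ℓ L (2 * t) / projSlabZ ρ β z n ℓ L t ^ 2

omit [TopologicalSpace G] [IsTopologicalGroup G] [CompactSpace G] [MeasurableSpace G] [BorelSpace G] in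
/-- Every read entry of the slab tensor is central when `zM, zE` are. -/
theorem slabTwist_center {zM zE : G} (hM : zM ∈ Subgroup.center G) (hE : zE ∈ Subgroup.center G) (μ ν : Fin 4) :
    slabTwist zM zE μ ν ∈ Subgroup.center G := by
  unfold slabTwist
  split_ifs
  · exact hM
  · exact hE
  · exact Subgroup.one_mem _

end Defs

/-- **Isolating twist** (pure group theory): `z` is the commutator of SOME pair, all pairs with commutator `z` form ONE simultaneous
conjugation orbit, and the simultaneous centraliser of such a pair is finite — 't Hooft's twist-eating pair is unique modulo gauge and
leaves no flat direction (`SU(N)` with `z` a generator of `Z_N`: clock and shift; fails for non-generating `z` and for the types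
`B, C, D, E₆, E₇`, where almost-commuting pairs have moduli; centre-free `G₂, F₄, E₈` have no `z ≠ 1` at all). -/
def HasIsolatingTwist (G : Type) [Group G] (z : G) : Prop :=
  (∃ A B : G, A * B * A⁻¹ * B⁻¹ = z) ∧
  (∀ A B A' B' : G, A * B * A⁻¹ * B⁻¹ = z → A' * B' * A'⁻¹ * B'⁻¹ = z →
      ∃ g : G, A' = g * A * g⁻¹ ∧ B' = g * B * g⁻¹) ∧
  (∀ A B : G, A * B * A⁻¹ * B⁻¹ = z → {g : G | g * A * g⁻¹ = A ∧ g * B * g⁻¹ = B}.Finite)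

/-! ## §2 The obligation Props -/

/-- **T1 · ANCHOR — the e-flux-projected twisted femto slab is pure, uniformly in the coupling and in the long extents.**  For
simply-connected compact simple `G`, a central `z ≠ 1` of finite order carrying an ISOLATING twist, and every lattice representation `r`:
there are a transverse size `ℓ₀ ≥ 2`, a threshold `β₀` and constants `c > 0`, `C` with
`projSlabDefect r.ρ β z n ℓ₀ L t ≤ C · L · e^{−c t}` for ALL `β ≥ β₀`, `L ≥ 2`, `t ≥ 1` — the lattice gap `c ≍ 1/(Nℓ₀)` of the
twist-eating slab is tree-level, hence `β`-uniform; the factor `L` is the one-dimensional multiplicity of its excitations.  No floor, no unit map. -/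
def TwistedSlabAnchor : Prop :=
  ∀ (G : Type) [Group G] [TopologicalSpace G] [IsTopologicalGroup G] [CompactSpace G],
    IsCompactSimpleLieGroup G → SimplyConnectedSpace G →
    letI : MeasurableSpace G := borel G
    haveI : BorelSpace G := ⟨rfl⟩
    ∀ (z : G) (n : ℕ), z ∈ Subgroup.center G → z ≠ 1 → 0 < n → z ^ n = 1 → HasIsolatingTwist G z →
      ∀ r : LatticeRep G, ∃ (ℓ₀ : ℕ) (β₀ c C : ℝ), 2 ≤ ℓ₀ ∧ 0 < c ∧
        ∀ β : ℝ, β₀ ≤ β → ∀ L t : ℕ, 2 ≤ L → 1 ≤ t →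
          projSlabDefect r.ρ β z n ℓ₀ L t ≤ C * (L : ℝ) * Real.exp (-(c * (t : ℝ)))

/-- **T2 · CONTINUITY IN THE TRANSVERSE SIZE — THE NAMED STALL (rank 2).**  For simply-connected compact simple `G`, central `z` of finite
order, every `r`, every positive unit map `a → 0` carrying the floor `LowerBounds G r a`, and anchor data `(ℓ₀, β₀, c, C)` as in T1: for every
window floor `λ` there is `T` such that for every `β₁` SOME `β ≥ β₁` has ONE scale `L ≥ max(8, ℓ₀)` with `λ ≤ a(β)·L ≤ T` at which the projected
twisted slabs `(ℓ, ℓ, L; ⌊L/4⌋)` are `θ`-pure for EVERY transverse size `ℓ₀ ≤ ℓ ≤ L` — from the femto slab (`ℓ = ℓ₀`, where it is the anchor)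
through `ℓ·a(β) ≍ Λ⁻¹` (the prior route's «N·L·Λ ∼ 1») to the full twisted cold box `ℓ = L`.  The bet: along this path NO centre symmetry can
break and no light sector opens, so purity is monotone-in-spirit; the content at `ℓ = L` is the Yang–Mills mass gap (width 0). -/
def TransverseSizeContinuity (θ : ℝ) : Prop :=
  ∀ (G : Type) [Group G] [TopologicalSpace G] [IsTopologicalGroup G] [CompactSpace G],
    IsCompactSimpleLieGroup G → SimplyConnectedSpace G →
    letI : MeasurableSpace G := borel G
    haveI : BorelSpace G := ⟨rfl⟩
    ∀ (z : G) (n : ℕ), z ∈ Subgroup.center G → 0 < n → z ^ n = 1 →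
      ∀ (r : LatticeRep G) (a : ℝ → ℝ), (∀ β, 0 < a β) → Tendsto a atTop (𝓝 0) → LowerBounds G r a →
        ∀ (ℓ₀ : ℕ) (β₀ c C : ℝ), 0 < c →
          (∀ β : ℝ, β₀ ≤ β → ∀ L t : ℕ, 2 ≤ L → 1 ≤ t →
            projSlabDefect r.ρ β z n ℓ₀ L t ≤ C * (L : ℝ) * Real.exp (-(c * (t : ℝ)))) →
          ∀ lam : ℝ, ∃ T : ℝ, ∀ β₁ : ℝ, ∃ β : ℝ, β₁ ≤ β ∧ ∃ L : ℕ, 8 ≤ L ∧ ℓ₀ ≤ L ∧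
            lam ≤ a β * (L : ℝ) ∧ a β * (L : ℝ) ≤ T ∧
            ∀ ℓ : ℕ, ℓ₀ ≤ ℓ → ℓ ≤ L → projSlabDefect r.ρ β z n ℓ L (L / 4) ≤ θ

/-- **T3 · 't HOOFT REGIME at the pinned cold box.**  For simply-connected compact simple `G`, every `r`, every positive unit map `a → 0`
carrying `LowerBounds G r a`: there is a window floor `λ` such that for every ceiling `T`, eventually in `β`, at EVERY scale `L ≥ 8` with
`λ ≤ a(β)·L ≤ T`, every twist tensor with central entries — all of 't Hooft's electric AND magnetic fluxes — costs at most the fraction `θ`: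
`(1 − θ)·Z(L³ × ⌊L/4⌋) ≤ W{w}(L³ × ⌊L/4⌋)`.  Heavy electric flux and light magnetic flux together ('t Hooft 1979 §7); false in a Coulomb
phase at aspect 4:1 (magnetic flux through `L × L` read over time `L/4` costs `e^{−cβ}`; electric flux is light). -/
def THooftRegime (θ : ℝ) : Prop :=
  ∀ (G : Type) [Group G] [TopologicalSpace G] [IsTopologicalGroup G] [CompactSpace G],
    IsCompactSimpleLieGroup G → SimplyConnectedSpace G →
    letI : MeasurableSpace G := borel G
    haveI : BorelSpace G := ⟨rfl⟩
    ∀ (r : LatticeRep G) (a : ℝ → ℝ), (∀ β, 0 < a β) → Tendsto a atTop (𝓝 0) → LowerBounds G r a →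
      ∃ lam : ℝ, ∀ T : ℝ, ∃ β₂ : ℝ, ∀ β : ℝ, β₂ ≤ β → ∀ L : ℕ, 8 ≤ L → lam ≤ a β * (L : ℝ) → a β * (L : ℝ) ≤ T →
        ∀ w : Fin 4 → Fin 4 → G, (∀ μ ν : Fin 4, w μ ν ∈ Subgroup.center G) →
          (1 - θ) * wilsonFinTorusPartition r.ρ β L L L (L / 4) ≤
            wilsonFinTorusTensorTwistedPartition r.ρ β w L L L (L / 4)

/-- **RESIDUAL (declared, not claimed): PXcof(θ) for the simply-connected compact simple groups WITHOUT an isolating central twist of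
finite order** — every simple type other than `A_{N−1}`.  The prior programme's audit ruling («centre-free `G` unreachable») typed as an item. -/
def NoIsolatingTwistResidual (θ : ℝ) : Prop :=
  ∀ (G : Type) [Group G] [TopologicalSpace G] [IsTopologicalGroup G] [CompactSpace G],
    IsCompactSimpleLieGroup G → SimplyConnectedSpace G →
    letI : MeasurableSpace G := borel G
    haveI : BorelSpace G := ⟨rfl⟩
    (¬ ∃ (z : G) (n : ℕ), z ∈ Subgroup.center G ∧ z ≠ 1 ∧ 0 < n ∧ z ^ n = 1 ∧ HasIsolatingTwist G z) →
      ∀ (r : LatticeRep G) (a : ℝ → ℝ), (∀ β, 0 < a β) → Tendsto a atTop (𝓝 0) → LowerBounds G r a →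
        ∃ T : ℝ, ∀ β₁ : ℝ, ∃ β : ℝ, β₁ ≤ β ∧ ∃ L : ℕ, 8 ≤ L ∧ a β * (L : ℝ) ≤ T ∧ coldDefect r.ρ β L ≤ θ

/-- **PXcof(θ)** — VERBATIM the slot's `PinnedCofinalBill.PinnedExitsCofinalAt θ` (idea-11 ∕ LEAD ab-p1): one pinned `θ`-pure cold `4:1`
box at cofinally many couplings, under the floor. -/
def PinnedExitsCofinalAt (θ : ℝ) : Prop :=
  ∀ (G : Type) [Group G] [TopologicalSpace G] [IsTopologicalGroup G] [CompactSpace G],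
    IsCompactSimpleLieGroup G → SimplyConnectedSpace G →
    letI : MeasurableSpace G := borel G
    haveI : BorelSpace G := ⟨rfl⟩
    ∀ (r : LatticeRep G) (a : ℝ → ℝ), (∀ β, 0 < a β) → Tendsto a atTop (𝓝 0) → LowerBounds G r a →
      ∃ T : ℝ, ∀ β₁ : ℝ, ∃ β : ℝ, β₁ ≤ β ∧ ∃ L : ℕ, 8 ≤ L ∧ a β * (L : ℝ) ≤ T ∧ coldDefect r.ρ β L ≤ θ

/-! ## §3 Stubs (sorries ONLY here) -/

/-- **stub T1 (anchor)** — located; first lemma of the line. -/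
theorem stub_anchor : TwistedSlabAnchor := by
  sorry

/-- **stub T2 (continuity in the transverse size)** — THE NAMED STALL of the resurrected route; load-bearing, rank 2. -/
theorem stub_continuity : TransverseSizeContinuity (1 / 96) := by
  sorry

/-- **stub T3 ('t Hooft regime at the pinned cold box)** — flux-sector content only. -/
theorem stub_tHooftRegime : THooftRegime (1 / 96) := by
  sorry

/-- **stub RESIDUAL** — PXcof(1∕24) for groups without an isolating twist (declared residual, not claimed). -/
theorem stub_residual : NoIsolatingTwistResidual (1 / 24) := by
  sorry

/-- **stub N_cof** — the `π₁(G) ≠ 1` conjunct of the leaf BY NAME (slot token). -/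
theorem stub_irnscCof : IRnscCof := by
  sorry

/-! ## §4 The endpoint seam (PROVED): projected twisted purity + 't Hooft regime + domination ⇒ periodic purity -/

section Seam

private theorem avg_le {n : ℕ} (hn : 0 < n) (f : Fin n → ℝ) (b : ℝ) (h : ∀ k, f k ≤ b) :
    (n : ℝ)⁻¹ * ∑ k, f k ≤ b := by
  have hs : ∑ k, f k ≤ ∑ _k : Fin n, b := Finset.sum_le_sum fun k _ => h k
  simp only [Finset.sum_const, Finset.card_univ, Fintype.card_fin, nsmul_eq_mul] at hs
  have hn' : (0 : ℝ) < n := by exact_mod_cast hn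
  rw [inv_mul_le_iff₀ hn']
  exact hs

private theorem le_avg {n : ℕ} (hn : 0 < n) (f : Fin n → ℝ) (b : ℝ) (h : ∀ k, b ≤ f k) :
    b ≤ (n : ℝ)⁻¹ * ∑ k, f k := by
  have hs : ∑ _k : Fin n, b ≤ ∑ k, f k := Finset.sum_le_sum fun k _ => h k
  simp only [Finset.sum_const, Finset.card_univ, Fintype.card_fin, nsmul_eq_mul] at hs
  have hn' : (0 : ℝ) < n := by exact_mod_cast hn
  rw [le_inv_mul_iff₀ hn']
  exact hs

/-- **The arithmetic of the seam.**  If `P ≥ (95/96)·Zt > 0` (flux regime, averaged), `P₂ ≤ Z₂` (domination, averaged) and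
`1 − P₂/P² ≤ 1/96` (projected twisted purity), then `1 − Z₂/Zt² ≤ 1/24` (indeed `≤ 1 − (95/96)³`). -/
theorem seam_arith {Zt Z2 P P2 : ℝ} (hZt : 0 < Zt) (hP : (1 - 1 / 96) * Zt ≤ P) (hP2 : P2 ≤ Z2)
    (hpure : 1 - P2 / P ^ 2 ≤ 1 / 96) : 1 - Z2 / Zt ^ 2 ≤ 1 / 24 := by
  have hPpos : 0 < P := lt_of_lt_of_le (by positivity) hP
  have hP2sq : 0 < P ^ 2 := by positivity
  have h1 : (1 - 1 / 96) * P ^ 2 ≤ P2 := by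
    have := hpure
    rw [sub_le_iff_le_add] at this
    have h' : 1 - 1 / 96 ≤ P2 / P ^ 2 := by linarith
    rwa [le_div_iff₀ hP2sq] at h'
  have h2 : (1 - 1 / 96) ^ 2 * Zt ^ 2 ≤ P ^ 2 := by
    have h0 : 0 ≤ (1 - 1 / 96) * Zt := by positivity
    nlinarith [hP, h0]
  have h3 : (1 - 1 / 96) ^ 3 * Zt ^ 2 ≤ Z2 := by nlinarith [h1, h2, hP2]
  have hZt2 : 0 < Zt ^ 2 := by positivity
  have h4 : (1 - 1 / 96) ^ 3 ≤ Z2 / Zt ^ 2 := by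
    rw [le_div_iff₀ hZt2]; exact h3
  nlinarith [h4]

end Seam

/-! ## §5 Composition (PROVED, stub-free): T1 ∧ T2 ∧ T3 ∧ residual ⇒ PXcof(1∕24) ⇒ IRscCof; with N_cof ⇒ `IRcof` BY NAME -/

/-- **PXcof(1∕24) from the four `π₁ = 1` obligations.**  Case split on the existence of an isolating central twist of finite order: if there is
one, the anchor T1 feeds T2, whose endpoint `ℓ = L` is a `1/96`-pure PROJECTED TWISTED cold box at a floor-pinned scale where T3 holds; the seam
(T3 at `⌊L/4⌋`, tree domination `W ≤ Z` at `2⌊L/4⌋`, `seam_arith`) gives `coldDefect ≤ 1/24`; otherwise the residual is the statement. -/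
theorem pxcof_of (hA : TwistedSlabAnchor) (hC : TransverseSizeContinuity (1 / 96)) (hH : THooftRegime (1 / 96))
    (hR : NoIsolatingTwistResidual (1 / 24)) : PinnedExitsCofinalAt (1 / 24) := by
  intro G _ _ _ _ hG hsc
  letI : MeasurableSpace G := borel G
  haveI : BorelSpace G := ⟨rfl⟩
  intro r a ha ha0 hlb
  haveI : SecondCountableTopology G :=
    (r.continuous.isClosedEmbedding r.injective).isEmbedding.secondCountableTopology
  by_cases hex : ∃ (z : G) (n : ℕ), z ∈ Subgroup.center G ∧ z ≠ 1 ∧ 0 < n ∧ z ^ n = 1 ∧ HasIsolatingTwist G z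
  · obtain ⟨z, n, hz, hz1, hn, hzn, hiso⟩ := hex
    obtain ⟨ℓ₀, β₀, c, C, -, hc, hanchor⟩ := hA G hG hsc z n hz hz1 hn hzn hiso r
    obtain ⟨lam, hH'⟩ := hH G hG hsc r a ha ha0 hlb
    obtain ⟨T, hT⟩ := hC G hG hsc z n hz hn hzn r a ha ha0 hlb ℓ₀ β₀ c C hc hanchor lam
    obtain ⟨β₂, hβ₂⟩ := hH' T
    refine ⟨T, fun β₁ => ?_⟩
    obtain ⟨β, hβ, L, hL8, hLℓ, hlam, hpin, hpath⟩ := hT (max β₁ (max β₂ 0))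
    have hβ1 : β₁ ≤ β := le_trans (le_max_left _ _) hβ
    have hβ2 : β₂ ≤ β := le_trans (le_trans (le_max_left _ _) (le_max_right _ _)) hβ
    have hβ0 : 0 ≤ β := le_trans (le_trans (le_max_right _ _) (le_max_right _ _)) hβ
    refine ⟨β, hβ1, L, hL8, hpin, ?_⟩
    -- the endpoint of the path: the projected twisted cold box is 1/96-pure
    have hend : projSlabDefect r.ρ β z n L L (L / 4) ≤ 1 / 96 := hpath L hLℓ le_rfl
    -- every summand of the projection is in 't Hooft's regime at ⌊L/4⌋ and dominated by Z at 2⌊L/4⌋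
    have hcent : ∀ k : Fin n, ∀ μ ν : Fin 4, slabTwist z (z ^ (k : ℕ)) μ ν ∈ Subgroup.center G :=
      fun k μ ν => slabTwist_center hz (Subgroup.pow_mem _ hz _) μ ν
    have hflux : ∀ k : Fin n, (1 - 1 / 96) * wilsonFinTorusPartition r.ρ β L L L (L / 4) ≤
        wilsonFinTorusTensorTwistedPartition r.ρ β (slabTwist z (z ^ (k : ℕ))) L L L (L / 4) :=
      fun k => hβ₂ β hβ2 L hL8 hlam hpin _ (hcent k)
    have hL2 : 2 ≤ L := by omega
    have h2t : 2 ≤ 2 * (L / 4) := by omega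
    have hdom : ∀ k : Fin n, wilsonFinTorusTensorTwistedPartition r.ρ β (slabTwist z (z ^ (k : ℕ))) L L L (2 * (L / 4)) ≤
        wilsonFinTorusPartition r.ρ β L L L (2 * (L / 4)) :=
      fun k => wilsonFinTorusTensorTwistedPartition_le_partition r.ρ r.continuous r.mem_unitary hβ0
        (fun μ ν _ => hcent k μ ν) hL2 hL2 h2t
    have hP : (1 - 1 / 96) * wilsonFinTorusPartition r.ρ β L L L (L / 4) ≤ projSlabZ r.ρ β z n L L (L / 4) :=
      le_avg hn _ _ hflux
    have hP2 : projSlabZ r.ρ β z n L L (2 * (L / 4)) ≤ wilsonFinTorusPartition r.ρ β L L L (2 * (L / 4)) :=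
      avg_le hn _ _ hdom
    have hZt : 0 < wilsonFinTorusPartition r.ρ β L L L (L / 4) := wilsonFinTorusPartition_pos r.continuous β L L L _
    have hpure : 1 - projSlabZ r.ρ β z n L L (2 * (L / 4)) / projSlabZ r.ρ β z n L L (L / 4) ^ 2 ≤ 1 / 96 := hend
    show 1 - wilsonFinTorusPartition r.ρ β L L L (2 * (L / 4)) / wilsonFinTorusPartition r.ρ β L L L (L / 4) ^ 2 ≤ 1 / 24
    exact seam_arith hZt hP hP2 hpure
  · exact hR G hG hsc hex r a ha ha0 hlb

/-- PXcof(θ ≤ 1∕24) ⇒ the simply-connected conjunct `IRscCof` of the leaf (landed kernel `ircofSC_of_pinnedExitsCofinal_le`). -/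
theorem irscCof_of_pxcof {θ : ℝ} (hθ : θ ≤ 1 / 24) (hP : PinnedExitsCofinalAt θ) : IRscCof := by
  intro G _ _ _ _ hG hsc
  exact ircofSC_of_pinnedExitsCofinal_le hθ hP G hG hsc

/-- The bill as ONE proposition (behind a `def`, so that `IRcof_of_stubs` is the file's only crux-headed theorem). -/
def Bill : Prop :=
  TwistedSlabAnchor → TransverseSizeContinuity (1 / 96) → THooftRegime (1 / 96) → NoIsolatingTwistResidual (1 / 24) → IRnscCof →
    Summit.QuantumFields.YangMills.Theses.BalabanLadder.IRcof

/-- **The bill holds** (PROVED composition, stub-free): `T1 → T2 → T3 → residual → N_cof → IRcof`. -/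
theorem IRcof_of : Bill := fun hA hC hH hR hN =>
  IRcof_of_split (irscCof_of_pxcof le_rfl (pxcof_of hA hC hH hR)) hN

/-- **`IRcof` (the route's decl, literally) from the five stubs.** -/
theorem IRcof_of_stubs : Summit.QuantumFields.YangMills.Theses.BalabanLadder.IRcof :=
  IRcof_of stub_anchor stub_continuity stub_tHooftRegime stub_residual stub_irnscCof

end Summit.QuantumFields.YangMills.Cruxes.IRcof.TwistedSlabContinuity

end
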